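import Summits.AtomisticToContinuum.FouriersLaw.Theorems.EmbeddedDrudeMourreDrudeDissolutionOfBmKineticCruxes
import Summits.AtomisticToContinuum.FouriersLaw.Theorems.EmbeddedDrudeMourreDrudeDissolutionStubBmRigidity
import Summits.AtomisticToContinuum.FouriersLaw.Theorems.EmbeddedDrudeMourreDrudeDissolutionIffMourre
import HarnessLib

/-!
# `DrudeDissolution` (stmt-AtomisticToContinuum-12593) — the split glue
# `BmPostKineticTail → BmKineticLimit → DrudeDissolution` (strategist s2, 2026-08-17)

Strategist file for crux `Summit.AtomisticToContinuum.FouriersLaw.Theses.EmbeddedDrudeMourre.DrudeDissolution`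
(route `EmbeddedDrudeMourre`, rank 0 target / auto-crux, sub-problem `FouriersLaw`), written by the crux-strategist
seat `planner-cstrat-stmt-AtomisticToContinuum-12593-s2-0` as the CERTIFICATE of the decomposition

  `DrudeDissolution ⇐ BmPostKineticTail ∧ BmKineticLimit`

filed with `ledger route edit route-AtomisticToContinuum-EmbeddedDrudeMourre --split DrudeDissolution --into …`.
The two hypotheses are spelled out VERBATIM: they are the statements of the two split children (the existential
Buttà–Marchioro forms of route KineticCorner's `PostKineticTail` / `KineticLimit`, stmt-3430 / stmt-3431, identical
byte-for-byte with the children prepared for the twin crux `MourreDissolution` in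
`Cruxes/MourreDissolution/SPLIT-PACKAGE.md`, so that the two twins dedupe onto ONE pair of leaf items).

Nothing new is proved here: `drudeDissolution_of_subs` is the landed composition
`LineSketch.drudeDissolution_of_bmRigidity_of_bmPostKineticTail_of_bmKineticLimit` (p127311,
`Theorems/EmbeddedDrudeMourreDrudeDissolutionOfBmKineticCruxes.lean`) with its first hypothesis (rigidity of the
Buttà–Marchioro class) discharged by the landed `LineSketch.stub_bmRigidity` (p127446,
`Theorems/EmbeddedDrudeMourreDrudeDissolutionStubBmRigidity.lean`); `mourreDissolution_of_subs` adds the landed weakening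
`mourreDissolution_of_drudeDissolution`. A prover-identity seat may land this file verbatim as
`Theorems/EmbeddedDrudeMourreDrudeDissolutionSplit.lean` (`--supports stmt-AtomisticToContinuum-12593`) and close the
gate-generated glue item `EmbeddedDrudeMourre.DrudeDissolutionOfKineticSubs` with
`fun h₁ h₂ => Summit.AtomisticToContinuum.FouriersLaw.Theorems.DrudeDissolution.StrategistSplit.drudeDissolution_of_subs h₁ h₂`
(definitional unfolding of the two child `def`s only; mock-checked in the strategist folder, `split/MockGlue.lean`, rc 0).
No definitions, no named facts, no `sorry`. References: folklore (bookkeeping over landed theorems).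
-/

namespace Summit.AtomisticToContinuum.FouriersLaw.Theorems.DrudeDissolution.StrategistSplit

/-- **`DrudeDissolution ⇐ BmPostKineticTail ∧ BmKineticLimit`** — the split glue of the route target
stmt-AtomisticToContinuum-12593 into its two kinetic leaf sub-cruxes in existential Buttà–Marchioro form:
(child 1, the wall) T-uniform far-tail smallness of the canonical summed current autocorrelation beyond every kinetic
multiple `M·T⁻²`; (child 2) the wave-kinetic limit on every finite kinetic window with a positive kinetic integral.
Proof: `drudeDissolution_of_bmRigidity_of_bmPostKineticTail_of_bmKineticLimit stub_bmRigidity`. [folklore] -/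
theorem drudeDissolution_of_subs :
    (∀ ω₂ lam β γ : ℝ, 0 < ω₂ → 0 < lam → 0 < β → 0 < γ → ∀ e : ℝ, 0 < e →
      ∃ M T₀ : ℝ, 0 < M ∧ 0 < T₀ ∧ ∀ T : ℝ, 0 < T → T < T₀ →
        ∃ (μ : MeasureTheory.Measure Literature.MathematicalPhysics.KineticTheory.HeatConduction.ChainConfig)
          (D : Literature.MathematicalPhysics.KineticTheory.HeatConduction.InfiniteChainDynamics
            (Literature.MathematicalPhysics.KineticTheory.HeatConduction.pinnedChain ω₂ lam β γ)),
          (Literature.MathematicalPhysics.KineticTheory.HeatConduction.pinnedChain ω₂ lam β γ).IsChainGibbsMeasure T μ ∧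
          MeasureTheory.MeasurePreserving
            (fun σ : Literature.MathematicalPhysics.KineticTheory.HeatConduction.ChainConfig => fun i : ℤ => σ (i + 1)) μ μ ∧
          D.carrier = (Literature.MathematicalPhysics.KineticTheory.HeatConduction.pinnedChain ω₂ lam β γ).bmGood ∧
          D.PreservesMeasure μ ∧
          MeasureTheory.IntegrableOn (D.currentCorrelation μ) (Set.Ioi (M / T ^ 2)) ∧
          ∫ t in Set.Ioi (M / T ^ 2), |D.currentCorrelation μ t| ≤ e) →
    (∀ ω₂ lam β γ : ℝ, 0 < ω₂ → 0 < lam → 0 < β → 0 < γ →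
      ∃ K : ℝ → ℝ, MeasureTheory.IntegrableOn K (Set.Ioi 0) ∧ 0 < ∫ τ in Set.Ioi 0, K τ ∧
        ∀ δ M e : ℝ, 0 < δ → δ ≤ M → 0 < e → ∃ T₀ : ℝ, 0 < T₀ ∧ ∀ T : ℝ, 0 < T → T < T₀ →
          ∃ (μ : MeasureTheory.Measure Literature.MathematicalPhysics.KineticTheory.HeatConduction.ChainConfig)
            (D : Literature.MathematicalPhysics.KineticTheory.HeatConduction.InfiniteChainDynamics
              (Literature.MathematicalPhysics.KineticTheory.HeatConduction.pinnedChain ω₂ lam β γ)),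
            (Literature.MathematicalPhysics.KineticTheory.HeatConduction.pinnedChain ω₂ lam β γ).IsChainGibbsMeasure T μ ∧
            MeasureTheory.MeasurePreserving
              (fun σ : Literature.MathematicalPhysics.KineticTheory.HeatConduction.ChainConfig => fun i : ℤ => σ (i + 1)) μ μ ∧
            D.carrier = (Literature.MathematicalPhysics.KineticTheory.HeatConduction.pinnedChain ω₂ lam β γ).bmGood ∧
            D.PreservesMeasure μ ∧
            |(∫ t in (δ / T ^ 2)..(M / T ^ 2), D.currentCorrelation μ t) - ∫ τ in δ..M, K τ| ≤ e) →
    Summit.AtomisticToContinuum.FouriersLaw.Theses.EmbeddedDrudeMourre.DrudeDissolution :=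
  fun h₁ h₂ =>
    LineSketch.drudeDissolution_of_bmRigidity_of_bmPostKineticTail_of_bmKineticLimit LineSketch.stub_bmRigidity h₁ h₂

/-- **`MourreDissolution ⇐ BmPostKineticTail ∧ BmKineticLimit`** — the same two children also split the twin crux
stmt-AtomisticToContinuum-12594 (weakening `mourreDissolution_of_drudeDissolution`; this is the
`mourreDissolution_of_subs` of `Cruxes/MourreDissolution/SPLIT-PACKAGE.md`). [folklore] -/
theorem mourreDissolution_of_subs :
    (∀ ω₂ lam β γ : ℝ, 0 < ω₂ → 0 < lam → 0 < β → 0 < γ → ∀ e : ℝ, 0 < e →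
      ∃ M T₀ : ℝ, 0 < M ∧ 0 < T₀ ∧ ∀ T : ℝ, 0 < T → T < T₀ →
        ∃ (μ : MeasureTheory.Measure Literature.MathematicalPhysics.KineticTheory.HeatConduction.ChainConfig)
          (D : Literature.MathematicalPhysics.KineticTheory.HeatConduction.InfiniteChainDynamics
            (Literature.MathematicalPhysics.KineticTheory.HeatConduction.pinnedChain ω₂ lam β γ)),
          (Literature.MathematicalPhysics.KineticTheory.HeatConduction.pinnedChain ω₂ lam β γ).IsChainGibbsMeasure T μ ∧
          MeasureTheory.MeasurePreserving
            (fun σ : Literature.MathematicalPhysics.KineticTheory.HeatConduction.ChainConfig => fun i : ℤ => σ (i + 1)) μ μ ∧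
          D.carrier = (Literature.MathematicalPhysics.KineticTheory.HeatConduction.pinnedChain ω₂ lam β γ).bmGood ∧
          D.PreservesMeasure μ ∧
          MeasureTheory.IntegrableOn (D.currentCorrelation μ) (Set.Ioi (M / T ^ 2)) ∧
          ∫ t in Set.Ioi (M / T ^ 2), |D.currentCorrelation μ t| ≤ e) →
    (∀ ω₂ lam β γ : ℝ, 0 < ω₂ → 0 < lam → 0 < β → 0 < γ →
      ∃ K : ℝ → ℝ, MeasureTheory.IntegrableOn K (Set.Ioi 0) ∧ 0 < ∫ τ in Set.Ioi 0, K τ ∧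
        ∀ δ M e : ℝ, 0 < δ → δ ≤ M → 0 < e → ∃ T₀ : ℝ, 0 < T₀ ∧ ∀ T : ℝ, 0 < T → T < T₀ →
          ∃ (μ : MeasureTheory.Measure Literature.MathematicalPhysics.KineticTheory.HeatConduction.ChainConfig)
            (D : Literature.MathematicalPhysics.KineticTheory.HeatConduction.InfiniteChainDynamics
              (Literature.MathematicalPhysics.KineticTheory.HeatConduction.pinnedChain ω₂ lam β γ)),
            (Literature.MathematicalPhysics.KineticTheory.HeatConduction.pinnedChain ω₂ lam β γ).IsChainGibbsMeasure T μ ∧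
            MeasureTheory.MeasurePreserving
              (fun σ : Literature.MathematicalPhysics.KineticTheory.HeatConduction.ChainConfig => fun i : ℤ => σ (i + 1)) μ μ ∧
            D.carrier = (Literature.MathematicalPhysics.KineticTheory.HeatConduction.pinnedChain ω₂ lam β γ).bmGood ∧
            D.PreservesMeasure μ ∧
            |(∫ t in (δ / T ^ 2)..(M / T ^ 2), D.currentCorrelation μ t) - ∫ τ in δ..M, K τ| ≤ e) →
    Summit.AtomisticToContinuum.FouriersLaw.Theses.EmbeddedDrudeMourre.MourreDissolution :=
  fun h₁ h₂ => mourreDissolution_of_drudeDissolution (drudeDissolution_of_subs h₁ h₂)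

end Summit.AtomisticToContinuum.FouriersLaw.Theorems.DrudeDissolution.StrategistSplit
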